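import Summits.HodgeConjecture.HodgeConjecture.Theorems.Ring2HypothesesCMPivot
import Summits.HodgeConjecture.HodgeConjecture.Theorems.Ring2TransportWeilTypeExactness
import Summits.HodgeConjecture.HodgeConjecture.Theorems.Ring2DeformCMPivotAnchors
import Summits.HodgeConjecture.HodgeConjecture.Theorems.Ring2TransportSemiregularGerm
import Summits.HodgeConjecture.HodgeConjecture.Theorems.WeilTypeLadderVariationalLocal
import Literature.AlgebraicGeometry.HodgeTheory.IsoTransport
import HarnessLib

/-!
# HSemireg venture · general structure (G4) — the WIRING, PER-COMPONENT ∃-form: ONE semiregular CM anchor per Hodge-locus component ⟹ `HC_AV`, modulo NAMED hypotheses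

HONEST FRAMING (speculative tier of cell `pub-hsemireg`, team «general structure», seat G4; verbatim the cell's wording rule):
**nothing here says `HC_AV` or `HC_CM` is proved; every implication carries its named hypotheses.** No `sorry`, no new axiom; axioms
`propext`, `Classical.choice`, `Quot.sound`. `HC_CM` = the OPEN route item `Theses.RankFourFaces.CMAbelianHodge`
(stmt-HodgeConjecture-3052), always a binder; `HC_AV` = `Theses.PadicSemiregularLift.HodgeAbelianVarieties` (stmt-HodgeConjecture-1333).

The companions (`GeneralStructureWiring*.lean`) ask the team's «uniform semiregularity» at EVERY CM fibre of every CM-anchored family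
(the antecedents of ring 2's `LocalVHCAtCM`). The team's coverage table (G3) and the transport seat's intake (`TRANSPORT-INTAKE-G4.md`
§3: «the Lean statement should quantify ∃ A₀ ∈ C, ∃ representative (per component), never ∀ representatives») ask for LESS: on each
component ONE CM point with ONE semiregular representative. This file types that weaker, per-component form and proves that it still
lands in `HC_AV` — by re-running ring 2's CM pivot with the anchor MOVED from Deligne's CM fibre `s₀` to the team's good CM fibre `s₁`
of the same (irreducible) base:

* `ExistsSemiregularSheafCMAnchor C` (§1, OURS, SPECULATIVE): for every smooth projective family `f : 𝒳 ⟶ S` of relative dimension `m`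
  (`𝒳`, `S` quasi-projective, `S` smooth irreducible) carrying a global class `G` rational `(p,p)` on abelian-presented fibres, which is
  CM-ANCHORED (some fibre is a CM abelian variety) and on which `G` is ALGEBRAIC AT EVERY CM-presented fibre (what `HC_CM` delivers),
  THERE IS a CM-presented fibre `s₁` at which `G|_{𝒳_{s₁}}` has a Buchweitz–Flenner semiregular presentation (the ∃-package of the sheaf
  form: `E_i` finite locally free on `𝒳_{s₁}`, `I_i ∋ p`, `I_i`-semiregular, `G|_{𝒳_{s₁}} = Σ c_i ch_p(E_i)`, `ch_q(E_i)` Hodge along paths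
  near `s₁`).
* A-0 `exists_isOpen_forall_mem_algebraicClasses_of_sheafLift` — the GERM STEP as a stand-alone lemma: BF 5.1 + a semiregular presentation
  at `s₁` ⟹ an open `U' ∋ s₁` of algebraic fibres (proof = the companions' G4-1).
* A-1 `hc_av_of_hc_cm_of_cmAnchoredFamilies_of_buchweitzFlenner_of_existsAnchor` — **`HC_CM ∧ CMAnchoredFamilies ∧ [BF 5.1] ∧
  ExistsSemiregularSheafCMAnchor ⟹ HC_AV`**: Deligne's packaging (`CMAnchoredFamilies`) of a Hodge class `c` on `A` gives the family and
  a CM fibre; `HC_CM` (`CMPivot.hodgeCM_of_cmAbelianHodge`, by name) makes `G` algebraic at every CM-presented fibre; the hypothesis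
  picks `s₁`; A-0 gives a non-empty open set of algebraic fibres; the tree's Baire / Hilbert-scheme lemma
  `WeilTypeLadder.mem_algebraicClasses_of_isOpen_subset_algebraicityLocus` (Charles–Schnell Prop. 11.3.11, proof; irreducible base)
  spreads it to every fibre, in particular to `A ≅ 𝒳_t`. `HC_CM` is load-bearing (it is the only source of algebraicity at `s₁`) and not
  dominated (the hypothesis speaks only of classes already algebraic at CM fibres).
* A-1′ with Deligne 1982 Prop. 6.1 supplied by print; A-2 `↔ HodgeWeilType`; A-3 the transport half `CMToAbelian` (no `HC_CM`).

VACUITY LEDGER (red team): (i) as in the companions, every hypothesis but `ExistsSemiregularSheafCMAnchor` is on-path or printed;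
(ii) the ∃-form is implied by the ∀-form `UniformSemiregularSheafLiftAtCM` of `GeneralStructureWiring.lean` on CM-anchored families
(take `s₁ := s₀`; stated there once both files are in the tree) — so it inherits «not refuted by the weak-criterion counterexample» and
is strictly easier to witness: G3's coverage table = one CM point per Weil component with an explicit representative is literally a list
of instances of its Weil sub-case; (iii) it is NOT implied by `HodgeConjecture` (it asserts sheaves): genuinely extra; (iv) honest label:
still PLAUSIBLY FALSE as a `∀` over all CM-anchored families of all Hodge classes (ring 2, ref1 F5), now with an `∃` over the CM points of
the base. Numbers: 1 new `@[conjecture] def`, 6 theorems, 0 sorries, 0 new facts.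

## References (bib keys)

BuchweitzFlenner2003 (§5 Thm. 5.1, Def. 4.1), Bloch1972Semiregularity (Introduction p. 51; Thm. 7.1, 7.4), Deligne1982HodgeCycles
(Prop. 6.1; §4), CharlesSchnell2014Notes (Prop. 11.3.11 (proof), Thm. 11.5.11), Mumford1969NoteShimura (§3), MumfordAV1970 (§22),
VoisinHodgeI2002 (§9.2.1), VoisinHodgeII2003 (§3.1.2), Markman2025SurveySecant (Question 11.4 sentence 1; preprint, unrefereed — statement only).
-/

noncomputable section

open CategoryTheory
open Literature.AlgebraicGeometry Literature.AlgebraicGeometry.Motives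
open Literature.AlgebraicGeometry.HodgeTheory
open Literature.AlgebraicGeometry.Deligne1982 (deligne1982_cmDenseMumfordTateFamilies)

namespace Summit.Ventures.HSemireg.GeneralStructure

open Summit.HodgeConjecture.HodgeConjecture
open Summit.HodgeConjecture.HodgeConjecture.Ring2.Hypotheses (CMAnchoredFamilies hc_av_iff_hc_cm_and_cmToAbelian)
open Summit.HodgeConjecture.HodgeConjecture.Ring2Transport (HodgeWeilType pathIn transportFun_pathIn_mono
  hodgeAbelianVarieties_iff_hodgeWeilType)
open Summit.HodgeConjecture.HodgeConjecture.Theorems.HodgeAbelianVarieties.CMPivot (hodgeCM_of_cmAbelianHodge)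

/-! ### §0 The CM-pivot vocabulary (verbatim ring 2's local notations) and the germ step as a lemma -/

/-- `IsCM[A]` — CM type in the eigenvalue typing (verbatim `Ring2HypothesesCMPivot`). Local notation only. -/
local notation3 (prettyPrint := false) "IsCM[" A "]" =>
  ∃ (ψ : A ⟶ A) (μ : Fin (2 * AbelianVariety.dim A) → ℂ), Function.Injective μ ∧
    ∀ i, Module.End.HasEigenvalue (HodgeTheory.complexBetti.map ψ.hom.hom.hom 1).hom (μ i)

/-- `QProj[X]` — `X` quasi-projective over `ℂ` (inlined body of `HodgeTheory.IsQuasiProjectiveOver X`). Local notation only. -/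
local notation3 (prettyPrint := false) "QProj[" X "]" =>
  ∃ (P : SchemeOver ℂ) (j : X ⟶ P), IsProjectiveOver P ∧ AlgebraicGeometry.IsOpenImmersion j.left

/-- `FibreIncl[f, B, e, s]` — `e` presents `B` as the fibre of `f` over `s`. Local notation only. -/
local notation3 (prettyPrint := false) "FibreIncl[" f ", " B ", " e ", " s "]" =>
  ∃ i : AbelianVariety.X B ≅ fiberOver f s, e = CategoryStruct.comp i.hom (fiberι f s)

/-- `HodgeAlong[S, 𝒳, f, G, p]` — `G` is rational `(p,p)` on every fibre presented as an abelian variety. Local notation only. -/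
local notation3 (prettyPrint := false) "HodgeAlong[" S ", " 𝒳 ", " f ", " G ", " p "]" =>
  ∀ (B : AbelianVariety ℂ) (eB : AbelianVariety.X B ⟶ 𝒳) (u : ComplexPoints S),
    FibreIncl[f, B, eB, u] →
      HodgeTheory.IsRationalClass (HodgeTheory.complexBetti.map eB (2 * p) G) ∧
      HodgeTheory.IsOfHodgeType B.dim B.X (2 * p) p p (HodgeTheory.complexBetti.map eB (2 * p) G)

/-- `SheafLift[C, f, m, p, G, s]` — **a Buchweitz–Flenner semiregular presentation of `G` at the fibre `s`**: a Euclidean-open `U ∋ s`,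
finitely many finite locally free `E_i` on `𝒳_s`, degree sets `I_i ∋ p`, `E_i` `I_i`-semiregular, `c_i ∈ ℂ` with
`G|_{𝒳_s} = Σ c_i ch_p(E_i)`, and `ch_q(E_i)` (`q ∈ I_i`) of type `(q,q)` along paths in `U` (the input package of
`BuchweitzFlenner2003_variationalHodge_ISemiregular`, `ℂ`-linearly extended; verbatim the conclusion of the companions' ∀-forms).
CAVEAT C1: FINITE LOCALLY FREE `E_i` only (the tree's BF 5.1 rendering; gap G44) — ideal sheaves / secant complexes are not instances as typed.
Local notation only. -/
local notation3 (prettyPrint := false) "SheafLift[" C ", " f ", " m ", " p ", " G ", " s "]" =>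
  ∃ (U : Set (ComplexPoints _)) (hs : s ∈ U), IsOpen U ∧
    ∃ (r : ℕ) (c : Fin r → ℂ) (E : Fin r → (fiberOver f s).left.Modules)
      (hE : ∀ i, IsFiniteLocallyFree (E i)) (Ideg : Fin r → Finset ℕ),
      (∀ i, p ∈ Ideg i) ∧ (∀ i, IsISemiregular (hE i) {q | q + 1 ∈ Ideg i}) ∧
      HodgeTheory.complexBetti.map (fiberι f s) (2 * p) G = ∑ i, c i • ChernCharacterBetti.ch C (fiberOver f s) (E i) p ∧
      ∀ (hU : IsCohomologicallyLocallyTrivialOn f U) (i : Fin r), ∀ q ∈ Ideg i,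
        ∀ (t : U) (γ : Path.Homotopic.Quotient (⟨s, hs⟩ : U) t),
          HodgeTheory.IsOfHodgeType m (fiberOver f t.1) (2 * q) q q
            (transportFun f (2 * q) hU γ (ChernCharacterBetti.ch C (fiberOver f s) (E i) q))

/-- **A-0 — THE GERM STEP (kernel-checked; literature input = Buchweitz–Flenner Thm. 5.1, refereed named fact).** On a smooth
projective family over a smooth quasi-projective base, a semiregular presentation of `G` at `s` yields a Euclidean-open `U' ∋ s` on
which `G|_{𝒳_t}` is algebraic: BF sheaf by sheaf (Ehresmann local triviality of the whole base,
`isCohomologicallyLocallyTrivialOn_univ_of_isQuasiProjectiveOver`), then the path component of `s` in `U ∩ ⋂ W_i` (`S(ℂ)` locally path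
connected), on which `G|_{𝒳_t}` is the `ℂ`-linear flat transport of `Σ c_i ch_p(E_i)` (`transportFun_map_fiberι`).
[cite: BuchweitzFlenner2003, §5 Thm. 5.1] [cite: VoisinHodgeI2002, §9.2.1] [cite: VoisinHodgeII2003, §3.1.2] -/
theorem exists_isOpen_forall_mem_algebraicClasses_of_sheafLift (C : ChernCharacterBetti)
    (hBF : BuchweitzFlenner2003_variationalHodge_ISemiregular) {𝒳 S : SchemeOver ℂ} (f : 𝒳 ⟶ S) {m p : ℕ}
    (hf : IsSmoothProjectiveFamily f m) (hqS : IsQuasiProjectiveOver S) (hsm : AlgebraicGeometry.Smooth S.hom)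
    (G : HodgeTheory.complexBetti 𝒳 (2 * p)) (s : ComplexPoints S) (hL : SheafLift[C, f, m, p, G, s]) :
    ∃ U' : Set (ComplexPoints S), IsOpen U' ∧ s ∈ U' ∧ ∀ t ∈ U',
      HodgeTheory.complexBetti.map (fiberι f t) (2 * p) G ∈ HodgeTheory.algebraicClasses (fiberOver f t) p := by
  obtain ⟨U, hsU, hUo, r, c, E, hE, Ideg, hpI, hsr, hsum, hHodge⟩ := hL
  have hU : IsCohomologicallyLocallyTrivialOn f U :=
    (isCohomologicallyLocallyTrivialOn_univ_of_isQuasiProjectiveOver f hf hqS hsm).mono (Set.subset_univ U) hUo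
  have hBFi : ∀ i : Fin r, ∃ (Wi : Set (ComplexPoints S)) (hWo : IsOpen Wi) (hW₀ : s ∈ Wi) (hWU : Wi ⊆ U),
      ∀ (t : Wi) (γ : Path.Homotopic.Quotient (⟨s, hW₀⟩ : Wi) t),
        transportFun f (2 * p) (hU.mono hWU hWo) γ (C.ch (fiberOver f s) (E i) p) ∈
          algebraicClasses (fiberOver f t.1) p := by
    intro i
    obtain ⟨Wi, hWo, hW₀, hWU, h⟩ := hBF C f m hf hsm hU ⟨s, hsU⟩ (E i) (hE i) (Ideg i) (hsr i)
      (fun q hq t γ ↦ hHodge hU i q hq t γ)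
    exact ⟨Wi, hWo, hW₀, hWU, fun t γ ↦ h p (hpI i) t γ⟩
  choose Wi hWio hW₀i hWiU hWialg using hBFi
  haveI := hsm
  haveI : LocallyPathConnectedSpace (ComplexPoints S) := locallyPathConnectedSpace_complexPoints_of_smooth S
  set W₀ : Set (ComplexPoints S) := U ∩ ⋂ i, Wi i with hW₀def
  have hW₀o : IsOpen W₀ := hUo.inter (isOpen_iInter_of_finite hWio)
  have hsW₀ : s ∈ W₀ := ⟨hsU, Set.mem_iInter.2 hW₀i⟩
  refine ⟨pathComponentIn W₀ s, hW₀o.pathComponentIn s, mem_pathComponentIn_self hsW₀, fun t ht ↦ ?_⟩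
  have hJ : JoinedIn W₀ s t := ht
  set γ₀ : Path s t := hJ.somePath
  have hγ : ∀ ρ, γ₀ ρ ∈ W₀ := hJ.somePath_mem
  have hγU : ∀ ρ, γ₀ ρ ∈ U := fun ρ ↦ (hγ ρ).1
  have hγi : ∀ i ρ, γ₀ ρ ∈ Wi i := fun i ρ ↦ Set.mem_iInter.1 (hγ ρ).2 i
  have hGt : complexBetti.map (fiberι f t) (2 * p) G =
      transportFun f (2 * p) hU ⟦pathIn γ₀ U hγU⟧ (complexBetti.map (fiberι f s) (2 * p) G) :=
    (transportFun_map_fiberι f (2 * p) hU ⟦pathIn γ₀ U hγU⟧ G).symm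
  have hlin : transportFun f (2 * p) hU ⟦pathIn γ₀ U hγU⟧ (∑ i, c i • C.ch (fiberOver f s) (E i) p) =
      ∑ i, c i • transportFun f (2 * p) hU ⟦pathIn γ₀ U hγU⟧ (C.ch (fiberOver f s) (E i) p) := by
    simp only [← transportLinear_apply, map_sum, map_smul]
  rw [hGt, hsum, hlin]
  refine Submodule.sum_mem _ fun i _ ↦ Submodule.smul_mem _ (c i) ?_
  have hi := hWialg i ⟨t, hγi i 1 |> fun h ↦ γ₀.target ▸ h⟩ ⟦pathIn γ₀ (Wi i) (hγi i)⟧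
  rw [transportFun_pathIn_mono f (2 * p) hU (hWiU i) (hWio i) γ₀ (hγi i)] at hi
  exact hi

/-! ### §1 The team's hypothesis, per-component ∃-form -/

/-- **`ExistsSemiregularSheafCMAnchor C` — ONE SEMIREGULAR CM ANCHOR PER COMPONENT (the «general structure» hypothesis of cell
`pub-hsemireg`, team G, in the form its coverage table G3 witnesses; OURS, SPECULATIVE, OPEN — NOT a Literature fact).** For every smooth
projective family `f : 𝒳 ⟶ S` of relative dimension `m` with `𝒳`, `S` quasi-projective and `S` smooth irreducible (a Hodge-locus /
Mumford–Tate component, after Deligne 1982 Prop. 6.1), every global class `G ∈ H^{2p}(𝒳(ℂ); ℂ)` rational `(p,p)` on abelian-presented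
fibres, such that the family is CM-ANCHORED (some fibre is presented by a CM abelian variety, eigenvalue typing `IsCM`) and `G` is
ALGEBRAIC at EVERY CM-presented fibre (what `HC_CM` delivers): THERE IS a CM-presented fibre `s₁` at which `G|_{𝒳_{s₁}}` has a
Buchweitz–Flenner semiregular presentation (`SheafLift`). CLOSEST PRINT: Bloch 1972, Introduction p. 51 («it reduces Grothendieck's
conjecture to the problem of finding semi-regular representatives») — with the representative GIVEN; Markman's Question 11.4 sentence 1
(open). HONEST LABEL: PLAUSIBLY FALSE as a `∀` over all CM-anchored families of all Hodge classes (ring 2, ref1 F5 on the Weil-confined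
form), here weakened to an `∃` over the CM points of each base; preferred form = per-component witnesses = the team's coverage table;
NOT a case of HC (it asserts sheaves); no on-path lemma. NOT asserted. CAVEAT C1 (transport review T-R4, 2026-08-22; numbers, not adjectives): `IsISemiregular` and the tree's
rendering of Buchweitz–Flenner Thm. 5.1 (`BuchweitzFlenner2003_variationalHodge_ISemiregular`) are for FINITE LOCALLY FREE `E_i`
ONLY (gap G44: the coherent-sheaf / perfect-complex versions — BF 2003 for modules, Pridham 2024, Perry 2026 — are not rendered);
ideal sheaves `I_Z`, `I_Z ⊠ I_{Z'}^∨` and secant complexes do NOT instantiate this statement as typed — they need a locally free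
(twisted) replacement, the lci door (`UniformBlochLiftAtCM`, Bloch 7.4), or an explicitly labelled BF-for-complexes binder; never a
hidden conversion. (Docstring revised 2026-08-22, words only, no declaration changed.)
QUANTIFIER SCOPE (RED-GS GS-8, 2026-08-22, accepted): the `∃` over CM fibres sits inside a `∀` over ALL admissible bases and base change
is free — on a generic curve through one CM point the statement is forced to that point, and on the point base `Spec ℂ` it ENTAILS the
deformation-free shadow (★) (kernel: `existsAnchor_pointBase`, `GeneralStructureWiringFamilies.lean`); so this is NOT «one witness per
component» (that is the ∃-over-FAMILIES form `SemiregularPresentedFamilies`, ibid., on which `HC_CM` is idle), but the statement between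
the ∀-form and the CM-dense form `ExistsSemiregularSheafCMAnchorDense` (ibid.; this ⟹ that). HIDDEN PARAMETER (red-1 V2-L4): an instance
`C : ChernCharacterBetti` (none vendored in the tree). (Docstring revised 2026-08-22, words only.)
[cite: Bloch1972Semiregularity, Introduction p. 51 and Thm. (7.4)]
[cite: BuchweitzFlenner2003, §5 Thm. 5.1] [cite: Markman2025SurveySecant, Question 11.4 sentence 1 (preprint / ICM 2026 lecture, unrefereed)]
[status: open, speculative] -/
@[conjecture] def ExistsSemiregularSheafCMAnchor (C : ChernCharacterBetti) : Prop :=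
  ∀ (S 𝒳 : SchemeOver ℂ) (f : 𝒳 ⟶ S) (m p : ℕ) (G : HodgeTheory.complexBetti 𝒳 (2 * p)),
    QProj[𝒳] → QProj[S] → AlgebraicGeometry.Smooth S.hom → IrreducibleSpace S.left →
    IsSmoothProjectiveFamily f m → HodgeAlong[S, 𝒳, f, G, p] →
    (∃ (s₀ : ComplexPoints S) (A₀ : AbelianVariety ℂ) (e₀ : A₀.X ⟶ 𝒳), FibreIncl[f, A₀, e₀, s₀] ∧ IsCM[A₀]) →
    (∀ (s : ComplexPoints S) (A' : AbelianVariety ℂ) (e' : A'.X ⟶ 𝒳), FibreIncl[f, A', e', s] → IsCM[A'] →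
      HodgeTheory.complexBetti.map e' (2 * p) G ∈ HodgeTheory.algebraicClasses A'.X p) →
    ∃ (s₁ : ComplexPoints S) (A₁ : AbelianVariety ℂ) (e₁ : A₁.X ⟶ 𝒳),
      FibreIncl[f, A₁, e₁, s₁] ∧ IsCM[A₁] ∧ SheafLift[C, f, m, p, G, s₁]

/-! ### §2 Row A-1: the CM pivot re-run with the team's anchor -/

/-- **A-1 — `HC_CM ∧ CMAnchoredFamilies ∧ [Buchweitz–Flenner 5.1] ∧ ExistsSemiregularSheafCMAnchor ⟹ HC_AV`** (kernel-checked). Given a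
rational `(p,p)` class `c` on `A`: Deligne's packaging (`CMAnchoredFamilies`) gives a CM-anchored family `f : 𝒳 ⟶ S` with a fibrewise
Hodge global class `G`, `G|_A = c` at `t`, a CM fibre at `s₀`; `HC_CM` makes `G` algebraic at EVERY CM-presented fibre
(`CMPivot.hodgeCM_of_cmAbelianHodge`); the hypothesis picks a CM fibre `s₁` with a semiregular presentation; A-0 gives a non-empty open
set of algebraic fibres; Baire + Hilbert schemes on the irreducible base
(`WeilTypeLadder.mem_algebraicClasses_of_isOpen_subset_algebraicityLocus`) make every fibre algebraic; pull back to `A ≅ 𝒳_t`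
(`mem_algebraicClasses_map_iff_of_iso`). `HC_CM` load-bearing, consumed once; a Hodge model on `A` by `nonempty_hodgeModel_holds`.
[cite: Deligne1982HodgeCycles, Prop. 6.1] [cite: BuchweitzFlenner2003, §5 Thm. 5.1] [cite: CharlesSchnell2014Notes, Prop. 11.3.11 (proof)]
[cite: MumfordAV1970, §22 (CM type)] -/
theorem hc_av_of_hc_cm_of_cmAnchoredFamilies_of_buchweitzFlenner_of_existsAnchor (C : ChernCharacterBetti)
    (hCM : Theses.RankFourFaces.CMAbelianHodge) (hMT : CMAnchoredFamilies)
    (hBF : BuchweitzFlenner2003_variationalHodge_ISemiregular) (hL : ExistsSemiregularSheafCMAnchor C) :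
    Theses.PadicSemiregularLift.HodgeAbelianVarieties := by
  intro A
  refine ⟨nonempty_hodgeModel_holds AbelianVariety.isSmoothProjective_holds, fun p c hc hh ↦ ?_⟩
  obtain ⟨S, 𝒳, f, G, t, s₀, e, A₀, e₀, h𝒳, hS, hsm, hirr, hf, hAt, hA₀, hcm, hGc, hG⟩ := hMT A p c hc hh
  -- `HC_CM`: `G` is algebraic at every CM-presented fibre
  have halgCM : ∀ (s : ComplexPoints S) (A' : AbelianVariety ℂ) (e' : A'.X ⟶ 𝒳), FibreIncl[f, A', e', s] → IsCM[A'] →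
      HodgeTheory.complexBetti.map e' (2 * p) G ∈ HodgeTheory.algebraicClasses A'.X p := by
    intro s A' e' he' hcm'
    have hH := hG A' e' s he'
    exact (hodgeCM_of_cmAbelianHodge hCM A' hcm').2 p _ hH.1 hH.2
  -- the team's anchor `s₁`
  obtain ⟨s₁, A₁, e₁, -, -, hlift⟩ := hL S 𝒳 f A.dim p G h𝒳 hS hsm hirr hf hG ⟨s₀, A₀, e₀, hA₀, hcm⟩ halgCM
  have hqS : IsQuasiProjectiveOver S := hS
  have hq𝒳 : IsQuasiProjectiveOver 𝒳 := h𝒳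
  obtain ⟨U', hU'o, hs₁U', hU'alg⟩ :=
    exists_isOpen_forall_mem_algebraicClasses_of_sheafLift C hBF f hf hqS hsm G s₁ hlift
  -- germ ⟹ every fibre (irreducible base)
  haveI := hirr
  have hall := WeilTypeLadder.mem_algebraicClasses_of_isOpen_subset_algebraicityLocus f h𝒳 hqS hsm hf G hU'o
    ⟨s₁, hs₁U'⟩ hU'alg
  -- back to `A ≅ 𝒳_t`
  obtain ⟨i, hi⟩ := hAt
  have he : HodgeTheory.complexBetti.map e (2 * p) G =
      complexBetti.map i.hom (2 * p) (complexBetti.map (fiberι f t) (2 * p) G) := by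
    rw [hi, complexBetti.map_comp]
    rfl
  rw [← hGc, he]
  exact (mem_algebraicClasses_map_iff_of_iso i).2 (hall t)

/-- **A-1′ — the same with Deligne 1982 Prop. 6.1 supplied by print**: `HC_CM ∧ [Deligne 1982] ∧ [BF 5.1] ∧ ExistsSemiregularSheafCMAnchor
⟹ HC_AV`. THE END STATEMENT of seat G4 in the form the coverage table witnesses: `HC_AV` modulo one open item, two refereed printed
theorems, and «one semiregular CM anchor per component». [cite: Deligne1982HodgeCycles, Prop. 6.1] [cite: CharlesSchnell2014Notes, Thm. 11.5.11]
[cite: BuchweitzFlenner2003, §5 Thm. 5.1] -/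
theorem hc_av_of_hc_cm_of_deligne1982_of_buchweitzFlenner_of_existsAnchor (C : ChernCharacterBetti)
    (hCM : Theses.RankFourFaces.CMAbelianHodge) (hD : deligne1982_cmDenseMumfordTateFamilies)
    (hBF : BuchweitzFlenner2003_variationalHodge_ISemiregular) (hL : ExistsSemiregularSheafCMAnchor C) :
    Theses.PadicSemiregularLift.HodgeAbelianVarieties :=
  hc_av_of_hc_cm_of_cmAnchoredFamilies_of_buchweitzFlenner_of_existsAnchor C hCM
    (Ring2.Deform.cmAnchoredFamilies_of_deligne1982 hD) hBF hL

/-- **A-2 — `↔ HodgeWeilType`** (ring 2's exactness): the bundle gives the Hodge conjecture for every abelian variety of Weil type, which IS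
`HC_AV`. [cite: Deligne1982HodgeCycles, §4 Lemma 4.5 and Remark 4.10] [cite: BuchweitzFlenner2003, §5 Thm. 5.1] -/
theorem hodgeWeilType_of_hc_cm_of_deligne1982_of_buchweitzFlenner_of_existsAnchor (C : ChernCharacterBetti)
    (hCM : Theses.RankFourFaces.CMAbelianHodge) (hD : deligne1982_cmDenseMumfordTateFamilies)
    (hBF : BuchweitzFlenner2003_variationalHodge_ISemiregular) (hL : ExistsSemiregularSheafCMAnchor C) : HodgeWeilType :=
  hodgeAbelianVarieties_iff_hodgeWeilType.1
    (hc_av_of_hc_cm_of_deligne1982_of_buchweitzFlenner_of_existsAnchor C hCM hD hBF hL)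

/-- **A-3 — the TRANSPORT HALF, no `HC_CM`**: `CMAnchoredFamilies ∧ [BF 5.1] ∧ ExistsSemiregularSheafCMAnchor ⟹ CMToAbelian`
(stmt-HodgeConjecture-16267; abelian varieties are smooth projective, the item's guard is discharged by the binder it supplies).
[cite: Deligne1982HodgeCycles, Prop. 6.1] [cite: BuchweitzFlenner2003, §5 Thm. 5.1] -/
theorem cmToAbelian_of_cmAnchoredFamilies_of_buchweitzFlenner_of_existsAnchor (C : ChernCharacterBetti)
    (hMT : CMAnchoredFamilies) (hBF : BuchweitzFlenner2003_variationalHodge_ISemiregular)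
    (hL : ExistsSemiregularSheafCMAnchor C) : Theses.RankFourFaces.CMToAbelian :=
  fun hCM A _ ↦ hc_av_of_hc_cm_of_cmAnchoredFamilies_of_buchweitzFlenner_of_existsAnchor C hCM hMT hBF hL A

/-- **POSITION of the ∃-form** (conjunction of tree theorems): the bundle's `HC_AV` is exactly `HC_CM ∧ CMToAbelian` and exactly
`HodgeWeilType` (ring 2); A-3 says the ∃-form + printed anchors + BF 5.1 is a sufficient condition for the open item `CMToAbelian`.
[cite: Deligne1982HodgeCycles, Prop. 6.1 and §4] -/
theorem existsAnchor_position (C : ChernCharacterBetti) :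
    (CMAnchoredFamilies → BuchweitzFlenner2003_variationalHodge_ISemiregular → ExistsSemiregularSheafCMAnchor C →
      Theses.RankFourFaces.CMToAbelian) ∧
    (Theses.PadicSemiregularLift.HodgeAbelianVarieties ↔
      Theses.RankFourFaces.CMAbelianHodge ∧ Theses.RankFourFaces.CMToAbelian) ∧
    (Theses.PadicSemiregularLift.HodgeAbelianVarieties ↔ HodgeWeilType) :=
  ⟨cmToAbelian_of_cmAnchoredFamilies_of_buchweitzFlenner_of_existsAnchor C, hc_av_iff_hc_cm_and_cmToAbelian,
    hodgeAbelianVarieties_iff_hodgeWeilType⟩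

/-! ## Audit: nothing is decided here

Every theorem above whose conclusion is `HC_AV`, `HodgeWeilType` or `CMToAbelian` has among its hypotheses the team's OPEN, SPECULATIVE
`ExistsSemiregularSheafCMAnchor C` together with named printed facts (Deligne 1982 Prop. 6.1 or `CMAnchoredFamilies`; Buchweitz–Flenner
Thm. 5.1) and — where load-bearing — `HC_CM` by name; A-0 is conditional on Buchweitz–Flenner only; the position row is a conjunction of
tree theorems. Axiom closures: the three standard axioms only. -/

#print axioms Summit.Ventures.HSemireg.GeneralStructure.exists_isOpen_forall_mem_algebraicClasses_of_sheafLift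
#print axioms Summit.Ventures.HSemireg.GeneralStructure.hc_av_of_hc_cm_of_cmAnchoredFamilies_of_buchweitzFlenner_of_existsAnchor

end Summit.Ventures.HSemireg.GeneralStructure

end
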